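import Literature.MathematicalPhysics.QuantumLattice.KomaPiFluxSumRule
import Literature.MathematicalPhysics.QuantumLattice.KomaPiFluxHoppingDoubleCommutator
import HarnessLib

/-!
# The averaged double commutator `|Λ|⁻¹ Σ_p c_p` (Koma 2022, (6.25)–(6.33))

T. Koma, *Nambu–Goldstone modes for superconducting lattice fermions*, arXiv:2201.13135 (2022)
[Koma2022], §6: the Kennedy–Lieb–Shastry argument needs the momentum AVERAGE of the double
commutators `c_p = ⟨[Γ̂¹_{-p},[H,Γ̂¹_p]]⟩` ((6.15), (6.22)), which Koma bounds in (6.33):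
`|Λ|⁻¹ Σ_p c_p ≤ 8d|κ| + 4dg E₁`.

With the real modes `C_p, S_p` and `doubleComm` of `KomaPiFluxThermalTwoPointBound.lean` we PROVE:

* `KomaPiFlux.doubleComm_gammaOneMode` — bilinear expansion
  `doubleComm(Γ¹[c]) = Σ_{x,y} c(x)c(y) Re⟨Γ¹_x[H,Γ¹_y] - [H,Γ¹_x]Γ¹_y⟩`;
* `KomaPiFlux.doubleComm_modes_sumRule` — Plancherel:
  `Σ_p (doubleComm C_p + doubleComm S_p) = L^{d+1} Σ_x Re⟨[Γ¹_x,[H,Γ¹_x]]⟩`;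
* `KomaPiFlux.sum_dcKernel_diag_eq` — with `KomaPiFluxDoubleCommutator` / `KomaPiFluxHoppingDoubleCommutator`,
  for `H₀ = H(κ,U,g,h=0,B)`: `Σ_x Re⟨[Γ¹_x,[H₀,Γ¹_x]]⟩ = Σ_x Re⟨[Γ¹_x,[K,Γ¹_x]]⟩ + 2g Σ_{x∼y} Re⟨Γ²_xΓ²_y⟩ + 4B Σ_x Re⟨Γ²_x⟩`;
* `KomaPiFlux.re_gibbsState_gammaTwo_mul_le_one` — `Re⟨Γ²_xΓ²_y⟩ ≤ 1` (positivity; `(Γ²)² = 1 - (n_↑-n_↓)²`);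
* `KomaPiFlux.doubleComm_modes_sum_le` — at `B = 0`:
  `Σ_p (doubleComm C_p + doubleComm S_p) ≤ (8κ + 4g)(d+1) L^{2(d+1)}` — Koma's (6.33) with the
  nearest-neighbour `η` correlation bounded by `1` (his `E₁ ≤ 1`), i.e. `|Λ|⁻¹Σ_p c_p ≤ (8|κ| + 4g)D`.

No named fact.

## References

* [Koma2022] T. Koma, arXiv:2201.13135, (6.15), (6.22), (6.25)–(6.33).
-/

noncomputable section

namespace Literature.MathematicalPhysics.QuantumLattice

open Matrix Finset HubbardWave0 PairHopRP FermionTorus LiebCutRP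
open Literature.Probability.LatticeModels
open scoped ComplexOrder

namespace KomaPiFlux

attribute [local instance] LiebCutRP.decEqTorus

variable {d L : ℕ} [NeZero L]

/-! ### The double-commutator kernel and its Plancherel identity -/

/-- The double-commutator kernel `Re⟨Γ¹_x (HΓ¹_y - Γ¹_yH) - (HΓ¹_x - Γ¹_xH) Γ¹_y⟩_{β,H}`; its diagonal is
the local double commutator `Re⟨[Γ¹_x,[H,Γ¹_x]]⟩`. [cite: Koma2022, (6.15)] -/
def dcKernel (β : ℝ) (H : Matrix (Finset (Orb (FermionTorus (d + 1) L))) (Finset (Orb (FermionTorus (d + 1) L))) ℂ)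
    (x y : FermionTorus (d + 1) L) : ℝ :=
  (gibbsState β H (gammaOne x * (H * gammaOne y - gammaOne y * H) - (H * gammaOne x - gammaOne x * H) * gammaOne y)).re

omit [NeZero L] in
/-- **Bilinear expansion**: `doubleComm(Γ¹[c]) = Σ_{x,y} c(x) c(y) dcKernel x y`. [cite: Koma2022, (6.15)] -/
theorem doubleComm_gammaOneMode (β : ℝ)
    (H : Matrix (Finset (Orb (FermionTorus (d + 1) L))) (Finset (Orb (FermionTorus (d + 1) L))) ℂ)
    (c : FermionTorus (d + 1) L → ℝ) :
    doubleComm β H (gammaOneMode c) =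
      ∑ x : FermionTorus (d + 1) L, ∑ y : FermionTorus (d + 1) L, c x * c y * dcKernel β H x y := by
  have hcomm : H * gammaOneMode c - gammaOneMode c * H =
      ∑ y : FermionTorus (d + 1) L, (c y : ℂ) • (H * gammaOne y - gammaOne y * H) := by
    unfold gammaOneMode
    rw [Finset.mul_sum, Finset.sum_mul, ← Finset.sum_sub_distrib]
    refine Finset.sum_congr rfl fun y _ => ?_
    rw [Matrix.mul_smul, Matrix.smul_mul, smul_sub]
  have h1 : gammaOneMode c * (H * gammaOneMode c - gammaOneMode c * H) =
      ∑ x : FermionTorus (d + 1) L, ∑ y : FermionTorus (d + 1) L,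
        ((c x * c y : ℝ) : ℂ) • (gammaOne x * (H * gammaOne y - gammaOne y * H)) := by
    rw [hcomm]
    unfold gammaOneMode
    rw [Finset.sum_mul]
    refine Finset.sum_congr rfl fun x _ => ?_
    rw [Finset.mul_sum]
    refine Finset.sum_congr rfl fun y _ => ?_
    rw [Matrix.smul_mul, Matrix.mul_smul, smul_smul, Complex.ofReal_mul]
  have h2 : (H * gammaOneMode c - gammaOneMode c * H) * gammaOneMode c =
      ∑ x : FermionTorus (d + 1) L, ∑ y : FermionTorus (d + 1) L,
        ((c x * c y : ℝ) : ℂ) • ((H * gammaOne x - gammaOne x * H) * gammaOne y) := by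
    rw [hcomm]
    unfold gammaOneMode
    rw [Finset.sum_mul]
    refine Finset.sum_congr rfl fun x _ => ?_
    rw [Finset.mul_sum]
    refine Finset.sum_congr rfl fun y _ => ?_
    rw [Matrix.smul_mul, Matrix.mul_smul, smul_smul, Complex.ofReal_mul]
  rw [doubleComm, h1, h2, ← Finset.sum_sub_distrib, map_sum, Complex.re_sum]
  refine Finset.sum_congr rfl fun x _ => ?_
  rw [← Finset.sum_sub_distrib, map_sum, Complex.re_sum]
  refine Finset.sum_congr rfl fun y _ => ?_
  rw [← smul_sub, map_smul, smul_eq_mul, Complex.re_ofReal_mul, dcKernel]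

/-- The double commutators of the two real modes at momentum `p`:
`doubleComm C_p + doubleComm S_p = Σ_{x,y} cos(p·(x̄-ȳ)) dcKernel x y`. [cite: Koma2022, (6.15)] -/
theorem doubleComm_modes_eq (β : ℝ)
    (H : Matrix (Finset (Orb (FermionTorus (d + 1) L))) (Finset (Orb (FermionTorus (d + 1) L))) ℂ)
    (p : TorusSite (d + 1) L) :
    doubleComm β H (gammaOneMode (cosWave p)) + doubleComm β H (gammaOneMode (sinWave p)) =
      ∑ x : FermionTorus (d + 1) L, ∑ y : FermionTorus (d + 1) L,
        Real.cos (torusPhase L p (toTorusSite x - toTorusSite y)) * dcKernel β H x y := by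
  rw [doubleComm_gammaOneMode, doubleComm_gammaOneMode, ← Finset.sum_add_distrib]
  refine Finset.sum_congr rfl fun x _ => ?_
  rw [← Finset.sum_add_distrib]
  refine Finset.sum_congr rfl fun y _ => ?_
  rw [cosWave, cosWave, sinWave, sinWave, cos_torusPhase_sub L]
  ring

/-- **Plancherel for the double commutators**:
`Σ_p (doubleComm C_p + doubleComm S_p) = L^{d+1} Σ_x Re⟨[Γ¹_x,[H,Γ¹_x]]⟩`. [cite: Koma2022, (6.15), (6.22)] -/
theorem doubleComm_modes_sumRule (β : ℝ)
    (H : Matrix (Finset (Orb (FermionTorus (d + 1) L))) (Finset (Orb (FermionTorus (d + 1) L))) ℂ) :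
    ∑ p : TorusSite (d + 1) L,
        (doubleComm β H (gammaOneMode (cosWave p)) + doubleComm β H (gammaOneMode (sinWave p))) =
      (L : ℝ) ^ (d + 1) * ∑ x : FermionTorus (d + 1) L, dcKernel β H x x := by
  simp_rw [doubleComm_modes_eq]
  rw [Finset.sum_comm, Finset.mul_sum]
  refine Finset.sum_congr rfl fun x _ => ?_
  rw [Finset.sum_comm]
  simp_rw [← Finset.sum_mul, sum_cos_torusPhase, sub_eq_zero, ite_mul, zero_mul]
  rw [Finset.sum_eq_single x (fun y _ hyx => if_neg (fun h => hyx (toTorusSite_injective h).symm))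
    (fun h => absurd (Finset.mem_univ x) h), if_pos rfl]

/-! ### The diagonal of the kernel for the pair-hopping Hamiltonian at `h = 0` -/

/-- **`Σ_x Re⟨[Γ¹_x,[H₀,Γ¹_x]]⟩ = Σ_x Re⟨[Γ¹_x,[K(T_π),Γ¹_x]]⟩ + 2g Σ_x Σ_{y∼x} Re⟨Γ²_xΓ²_y⟩ + 4B Σ_x Re⟨Γ²_x⟩`**
for `H₀ = H(κ,U,g,0,B)` and any inverse temperature / any state Hamiltonian `H'`.
[cite: Koma2022, (6.25)–(6.29)] -/
theorem sum_dcKernel_diag_eq (β : ℝ)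
    (H' : Matrix (Finset (Orb (FermionTorus (d + 1) L))) (Finset (Orb (FermionTorus (d + 1) L))) ℂ)
    (κ U g B : ℝ) :
    ∑ x : FermionTorus (d + 1) L, (gibbsState β H'
        (gammaOne x * (hamiltonian κ U g (fun (_ _ : FermionTorus (d + 1) L) => (0 : ℝ)) B * gammaOne x -
            gammaOne x * hamiltonian κ U g (fun (_ _ : FermionTorus (d + 1) L) => (0 : ℝ)) B) -
          (hamiltonian κ U g (fun (_ _ : FermionTorus (d + 1) L) => (0 : ℝ)) B * gammaOne x -
            gammaOne x * hamiltonian κ U g (fun (_ _ : FermionTorus (d + 1) L) => (0 : ℝ)) B) * gammaOne x)).re =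
      ∑ x : FermionTorus (d + 1) L, (gibbsState β H'
        (gammaOne x * (peierlsHubbard (G d L) (piFluxAmpl κ) 0 * gammaOne x - gammaOne x * peierlsHubbard (G d L) (piFluxAmpl κ) 0) -
          (peierlsHubbard (G d L) (piFluxAmpl κ) 0 * gammaOne x - gammaOne x * peierlsHubbard (G d L) (piFluxAmpl κ) 0) *
            gammaOne x)).re +
      2 * g * ∑ x : FermionTorus (d + 1) L, ∑ y : FermionTorus (d + 1) L,
        (if (G d L).Adj x y then (gibbsState β H' (gammaTwo x * gammaTwo y)).re else 0) +
      4 * B * ∑ x : FermionTorus (d + 1) L, (gibbsState β H' (gammaTwo x)).re := by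
  unfold hamiltonian
  simp_rw [gammaOne_doubleComm_hamiltonian (G d L) (piFluxAmpl κ) U g B]
  rw [Finset.mul_sum, Finset.mul_sum, ← Finset.sum_add_distrib, ← Finset.sum_add_distrib]
  refine Finset.sum_congr rfl fun x _ => ?_
  have hS : (gibbsState β H' (∑ y : FermionTorus (d + 1) L,
      if (G d L).Adj x y then gammaTwo x * gammaTwo y else 0)).re =
      ∑ y : FermionTorus (d + 1) L, (if (G d L).Adj x y then (gibbsState β H' (gammaTwo x * gammaTwo y)).re else 0) := by
    rw [map_sum, Complex.re_sum]
    refine Finset.sum_congr rfl fun y _ => ?_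
    split_ifs
    · rfl
    · rw [map_zero, Complex.zero_re]
  rw [map_add, map_add, Complex.add_re, Complex.add_re, map_smul, map_smul, smul_eq_mul, smul_eq_mul,
    Complex.re_ofReal_mul, Complex.re_ofReal_mul, hS]

/-! ### `Re⟨Γ²_xΓ²_y⟩ ≤ 1` -/

/-- `1 - (Γ¹_x)² = (n_{x↑} - n_{x↓})²` (so `(Γ¹)² = (Γ²)²` is the projection onto the `η`-doublet).
[cite: Koma2022, (3.7)] -/
theorem one_sub_gammaOne_sq {Λ : Type*} [LinearOrder Λ] [Fintype Λ] (x : Λ) :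
    1 - gammaOne x * gammaOne x = (numberOp x 0 - numberOp x 1) * (numberOp x 0 - numberOp x 1) := by
  have h0 : numberOp x 0 * numberOp x 0 = numberOp x 0 := (numberAt_idempotent (orb x 0)).eq
  have h1 : numberOp x 1 * numberOp x 1 = numberOp x 1 := (numberAt_idempotent (orb x 1)).eq
  have hc : numberOp x 1 * numberOp x 0 = numberOp x 0 * numberOp x 1 := (numberAt_commute (orb x 1) (orb x 0)).eq
  rw [gammaOne_mul_self_eq, Matrix.sub_mul, Matrix.mul_sub, Matrix.mul_sub, h0, h1, hc, two_smul]
  abel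

omit [NeZero L] in
/-- `Re⟨(Γ²_x)²⟩ ≤ 1` in any Gibbs state. [cite: Koma2022, (3.7), (6.33)] [cite: BratteliRobinson1997, §5.3.1] -/
theorem re_gibbsState_gammaTwo_sq_le_one (β : ℝ)
    {H : Matrix (Finset (Orb (FermionTorus (d + 1) L))) (Finset (Orb (FermionTorus (d + 1) L))) ℂ} (hH : H.IsHermitian)
    (x : FermionTorus (d + 1) L) : (gibbsState β H (gammaTwo x * gammaTwo x)).re ≤ 1 := by
  have hn : ∀ σ : Fin 2, (numberOp x σ)ᴴ = numberOp x σ := fun σ => by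
    rw [numberOp]; exact (numberAt_isHermitian (orb x σ)).eq
  have hA : (1 - gammaTwo x * gammaTwo x).PosSemidef := by
    rw [← gammaOne_sq_eq_gammaTwo_sq, one_sub_gammaOne_sq]
    have h : (numberOp x 0 - numberOp x 1)ᴴ = numberOp x 0 - numberOp x 1 := by rw [conjTranspose_sub, hn, hn]
    nth_rw 1 [← h]
    exact Matrix.posSemidef_conjTranspose_mul_self _
  have h0 := (Complex.nonneg_iff.mp (gibbsState_nonneg_of_posSemidef β hH hA)).1
  rw [map_sub, Complex.sub_re, gibbsState_one β H (partitionFn_pos β hH).ne', Complex.one_re] at h0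
  linarith

omit [NeZero L] in
/-- **`Re⟨Γ²_x Γ²_y⟩ ≤ 1`** in any Gibbs state (`(Γ²_x - Γ²_y)² ≥ 0` and `⟨(Γ²)²⟩ ≤ 1`).
[cite: Koma2022, (6.33)] [cite: BratteliRobinson1997, §5.3.1] -/
theorem re_gibbsState_gammaTwo_mul_le_one (β : ℝ)
    {H : Matrix (Finset (Orb (FermionTorus (d + 1) L))) (Finset (Orb (FermionTorus (d + 1) L))) ℂ} (hH : H.IsHermitian)
    (x y : FermionTorus (d + 1) L) : (gibbsState β H (gammaTwo x * gammaTwo y)).re ≤ 1 := by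
  by_cases hxy : x = y
  · subst hxy; exact re_gibbsState_gammaTwo_sq_le_one β hH x
  have hx := re_gibbsState_gammaTwo_sq_le_one β hH x
  have hy := re_gibbsState_gammaTwo_sq_le_one β hH y
  have hA : ((gammaTwo x - gammaTwo y)ᴴ * (gammaTwo x - gammaTwo y)).PosSemidef :=
    Matrix.posSemidef_conjTranspose_mul_self _
  have h0 := (Complex.nonneg_iff.mp (gibbsState_nonneg_of_posSemidef β hH hA)).1
  rw [conjTranspose_sub, (gammaTwo_isHermitian x).eq, (gammaTwo_isHermitian y).eq, Matrix.sub_mul, Matrix.mul_sub,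
    Matrix.mul_sub, gammaTwo_comm y x, map_sub, map_sub, map_sub, Complex.sub_re, Complex.sub_re, Complex.sub_re] at h0
  linarith

/-! ### The bound (6.33) -/

/-- **Koma's (6.33)** (Lieb frame, `B = 0`, the nearest-neighbour `η` correlation bounded by `1`): for
`H₀ = H(κ,U,g,0,0)` with `κ ≥ 0`, `g ≥ 0`, `L ≥ 3`, in the Gibbs state of `H₀`,
`Σ_p (doubleComm C_p + doubleComm S_p) ≤ (8κ + 4g)(d+1) L^{d+1} L^{d+1}`, i.e.
`|Λ|⁻¹ Σ_p c_p ≤ 8D|κ| + 4Dg`. [cite: Koma2022, (6.33)] -/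
theorem doubleComm_modes_sum_le (h3 : 3 ≤ L) {β : ℝ} {κ : ℝ} (hκ : 0 ≤ κ) (U : ℝ) {g : ℝ} (hg : 0 ≤ g) :
    ∑ p : TorusSite (d + 1) L,
        (doubleComm β (hamiltonian κ U g (fun (_ _ : FermionTorus (d + 1) L) => (0 : ℝ)) 0) (gammaOneMode (cosWave p)) +
          doubleComm β (hamiltonian κ U g (fun (_ _ : FermionTorus (d + 1) L) => (0 : ℝ)) 0) (gammaOneMode (sinWave p))) ≤
      (8 * κ + 4 * g) * (d + 1) * (L : ℝ) ^ (d + 1) * (L : ℝ) ^ (d + 1) := by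
  set H₀ := hamiltonian κ U g (fun (_ _ : FermionTorus (d + 1) L) => (0 : ℝ)) 0 with hH₀
  have hH : H₀.IsHermitian := hamiltonian_isHermitian (G d L) (piFluxAmpl κ) (piFluxAmpl_herm κ) U g _ 0
  rw [doubleComm_modes_sumRule]
  have hdiag : ∑ x : FermionTorus (d + 1) L, dcKernel β H₀ x x ≤ (8 * κ + 4 * g) * (d + 1) * (L : ℝ) ^ (d + 1) := by
    unfold dcKernel
    rw [hH₀, sum_dcKernel_diag_eq, mul_zero, zero_mul, add_zero, ← hH₀]
    have hK := sum_re_gibbsState_doubleComm_hopping_le (d := d) h3 hκ β hH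
    have hP : ∑ x : FermionTorus (d + 1) L, ∑ y : FermionTorus (d + 1) L,
        (if (G d L).Adj x y then (gibbsState β H₀ (gammaTwo x * gammaTwo y)).re else 0) ≤
        2 * (d + 1) * (L : ℝ) ^ (d + 1) := by
      have h2 : 2 ≤ L := by omega
      calc ∑ x : FermionTorus (d + 1) L, ∑ y : FermionTorus (d + 1) L,
            (if (G d L).Adj x y then (gibbsState β H₀ (gammaTwo x * gammaTwo y)).re else 0)
          ≤ ∑ x : FermionTorus (d + 1) L, ∑ y : FermionTorus (d + 1) L, (if (G d L).Adj x y then (1 : ℝ) else 0) := by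
            refine Finset.sum_le_sum fun x _ => Finset.sum_le_sum fun y _ => ?_
            split_ifs
            · exact re_gibbsState_gammaTwo_mul_le_one β hH x y
            · exact le_rfl
        _ = ∑ x : FermionTorus (d + 1) L, ∑ _μ : Fin (d + 1), ((1 : ℝ) + 1) := by
            rw [← sum_shift_add_sum_shift_swap h3 (fun (_ _ : FermionTorus (d + 1) L) => (1 : ℝ))]
        _ = 2 * (d + 1) * (L : ℝ) ^ (d + 1) := by
            rw [Finset.sum_const, Finset.sum_const, Finset.card_univ, Finset.card_univ, Fintype.card_fin, nsmul_eq_mul,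
              nsmul_eq_mul, Nat.cast_add, Nat.cast_one]
            rw [show (Fintype.card (FermionTorus (d + 1) L) : ℝ) = (L : ℝ) ^ (d + 1) by
              simp only [FermionTorus, Fintype.card_lex, Fintype.card_fun, Fintype.card_fin, Nat.cast_pow]]
            ring
    nlinarith [hK, hP, hg]
  have hLpos : (0 : ℝ) ≤ (L : ℝ) ^ (d + 1) := by positivity
  calc (L : ℝ) ^ (d + 1) * ∑ x : FermionTorus (d + 1) L, dcKernel β H₀ x x
      ≤ (L : ℝ) ^ (d + 1) * ((8 * κ + 4 * g) * (d + 1) * (L : ℝ) ^ (d + 1)) := by gcongr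
    _ = (8 * κ + 4 * g) * (d + 1) * (L : ℝ) ^ (d + 1) * (L : ℝ) ^ (d + 1) := by ring

end KomaPiFlux

end Literature.MathematicalPhysics.QuantumLattice

end
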